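import Mathlib
import HarnessLib
import Summits.AtomisticToContinuum.FouriersLaw.Theses.JunctionLocality
import Literature.MathematicalPhysics.KineticTheory.LangevinChainGibbs
import Summits.AtomisticToContinuum.FouriersLaw.Theorems.JunctionLocalitySuperadditiveResistanceDeviceGibbs

/-!
# The γ-probed device at equilibrium, II: coordinate-line calculus and the operators `X_H`, `S_B`

Part II of the helper development for stub `stub_linearResponse` (line
`thermalise-then-cut-probe-insertion`, crux stmt-AtomisticToContinuum-11748); see `…DeviceLiouville`
for the overview. Content: the coordinate derivatives `partialP/partialQ` of `FouriersLaw.lean` as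
one-variable derivatives of line restrictions (`lineP`, `lineQ`; product rules, second-order
Leibniz rule `deriv_deriv_mul_sq`), the Liouville operator `liouvilleOp` (`X_H`), the weighted
unit-strength thermostats `bathOp` (`S_B`) and the energy cutoff `cutoff φ r = φ(H/r)` with the
closed forms of `X_H` and `S_B` on `η w²` and on the cutoff (`X_H φ(H/r) = 0`).
-/

noncomputable section

open MeasureTheory Filter Topology ProbabilityTheory
open scoped ContDiff NNReal
open Literature.MathematicalPhysics.KineticTheory.HeatConduction

namespace Summit.AtomisticToContinuum.FouriersLaw.Theorems.SuperadditiveResistance.DeviceLiouville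

/-! ## Line calculus: the coordinate derivatives as one-variable derivatives -/

section LineCalculus

variable {L : ℕ}

/-- Restriction of `f` to the `p_i`-coordinate line through `x`. [folklore] -/
def lineP (i : Fin L) (f : PhaseSpace L → ℝ) (x : PhaseSpace L) (t : ℝ) : ℝ :=
  f (x.1, Function.update x.2 i t)

/-- Restriction of `f` to the `q_i`-coordinate line through `x`. [folklore] -/
def lineQ (i : Fin L) (f : PhaseSpace L → ℝ) (x : PhaseSpace L) (t : ℝ) : ℝ :=
  f (Function.update x.1 i t, x.2)

/-- `∂_{p_i} f (x)` is the derivative of the `p_i`-line restriction at `p_i`. [folklore] -/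
theorem partialP_eq_deriv_lineP (i : Fin L) (f : PhaseSpace L → ℝ) (x : PhaseSpace L) :
    partialP i f x = deriv (lineP i f x) (x.2 i) := rfl

/-- `∂_{q_i} f (x)` is the derivative of the `q_i`-line restriction at `q_i`. [folklore] -/
theorem partialQ_eq_deriv_lineQ (i : Fin L) (f : PhaseSpace L → ℝ) (x : PhaseSpace L) :
    partialQ i f x = deriv (lineQ i f x) (x.1 i) := rfl

/-- The line restriction of `∂_{p_i} f` is the derivative of the line restriction of `f`
(no hypothesis on `f`). [folklore] -/
theorem lineP_partialP (i : Fin L) (f : PhaseSpace L → ℝ) (x : PhaseSpace L) :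
    lineP i (partialP i f) x = deriv (lineP i f x) := by
  funext t
  simp only [lineP, partialP, Function.update_idem, Function.update_self]
  rfl

/-- The line restriction of `∂_{q_i} f` is the derivative of the line restriction of `f`. [folklore] -/
theorem lineQ_partialQ (i : Fin L) (f : PhaseSpace L → ℝ) (x : PhaseSpace L) :
    lineQ i (partialQ i f) x = deriv (lineQ i f x) := by
  funext t
  simp only [lineQ, partialQ, Function.update_idem, Function.update_self]
  rfl

/-- `∂_{p_i}∂_{p_i} f (x)` is the second derivative of the line restriction. [folklore] -/
theorem partialP_partialP_eq (i : Fin L) (f : PhaseSpace L → ℝ) (x : PhaseSpace L) :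
    partialP i (partialP i f) x = deriv (deriv (lineP i f x)) (x.2 i) := by
  rw [partialP_eq_deriv_lineP, lineP_partialP]

/-- The `p_i`-line through `x` passes through `x` at parameter `p_i`. [folklore] -/
@[simp] theorem lineP_apply_self (i : Fin L) (f : PhaseSpace L → ℝ) (x : PhaseSpace L) :
    lineP i f x (x.2 i) = f x := by simp [lineP]

/-- The `q_i`-line through `x` passes through `x` at parameter `q_i`. [folklore] -/
@[simp] theorem lineQ_apply_self (i : Fin L) (f : PhaseSpace L → ℝ) (x : PhaseSpace L) :
    lineQ i f x (x.1 i) = f x := by simp [lineQ]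

/-- The coordinate lines are smooth (affine) curves. [folklore] -/
theorem contDiff_lineP_id {n : WithTop ℕ∞} (i : Fin L) (x : PhaseSpace L) :
    ContDiff ℝ n (fun t : ℝ => ((x.1, Function.update x.2 i t) : PhaseSpace L)) :=
  contDiff_const.prodMk (contDiff_update n x.2 i)

/-- The `q_i`-coordinate lines are smooth (affine) curves. [folklore] -/
theorem contDiff_lineQ_id {n : WithTop ℕ∞} (i : Fin L) (x : PhaseSpace L) :
    ContDiff ℝ n (fun t : ℝ => ((Function.update x.1 i t, x.2) : PhaseSpace L)) :=
  (contDiff_update n x.1 i).prodMk contDiff_const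

/-- Line restrictions inherit smoothness. [folklore] -/
theorem contDiff_lineP {n : WithTop ℕ∞} {f : PhaseSpace L → ℝ} (hf : ContDiff ℝ n f) (i : Fin L)
    (x : PhaseSpace L) : ContDiff ℝ n (lineP i f x) :=
  hf.comp (contDiff_lineP_id i x)

/-- `q`-line restrictions inherit smoothness. [folklore] -/
theorem contDiff_lineQ {n : WithTop ℕ∞} {f : PhaseSpace L → ℝ} (hf : ContDiff ℝ n f) (i : Fin L)
    (x : PhaseSpace L) : ContDiff ℝ n (lineQ i f x) :=
  hf.comp (contDiff_lineQ_id i x)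

/-- Line restrictions inherit differentiability. [folklore] -/
theorem differentiable_lineP {f : PhaseSpace L → ℝ} (hf : Differentiable ℝ f) (i : Fin L)
    (x : PhaseSpace L) : Differentiable ℝ (lineP i f x) :=
  hf.comp ((contDiff_lineP_id (n := 1) i x).differentiable one_ne_zero)

/-- `q`-line restrictions inherit differentiability. [folklore] -/
theorem differentiable_lineQ {f : PhaseSpace L → ℝ} (hf : Differentiable ℝ f) (i : Fin L)
    (x : PhaseSpace L) : Differentiable ℝ (lineQ i f x) :=
  hf.comp ((contDiff_lineQ_id (n := 1) i x).differentiable one_ne_zero)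

/-- A `C²` function of one variable is differentiable with differentiable derivative. [folklore] -/
theorem differentiable_deriv_of_contDiff_two {g : ℝ → ℝ} (hg : ContDiff ℝ 2 g) :
    Differentiable ℝ g ∧ Differentiable ℝ (deriv g) := by
  rw [show (2 : WithTop ℕ∞) = 1 + 1 from rfl] at hg
  have h := (contDiff_succ_iff_deriv (n := 1) (f := g)).1 hg
  exact ⟨h.1, h.2.2.differentiable one_ne_zero⟩

/-- Product rule for `∂_{p_i}`. [folklore] -/
theorem partialP_mul {f g : PhaseSpace L → ℝ} (hf : Differentiable ℝ f) (hg : Differentiable ℝ g)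
    (i : Fin L) (x : PhaseSpace L) :
    partialP i (fun y => f y * g y) x = partialP i f x * g x + f x * partialP i g x := by
  have h := ((differentiable_lineP hf i x (x.2 i)).hasDerivAt.fun_mul
    (differentiable_lineP hg i x (x.2 i)).hasDerivAt).deriv
  simp only [lineP_apply_self] at h
  rw [partialP_eq_deriv_lineP, partialP_eq_deriv_lineP, partialP_eq_deriv_lineP, ← h]
  rfl

/-- Product rule for `∂_{q_i}`. [folklore] -/
theorem partialQ_mul {f g : PhaseSpace L → ℝ} (hf : Differentiable ℝ f) (hg : Differentiable ℝ g)
    (i : Fin L) (x : PhaseSpace L) :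
    partialQ i (fun y => f y * g y) x = partialQ i f x * g x + f x * partialQ i g x := by
  have h := ((differentiable_lineQ hf i x (x.1 i)).hasDerivAt.fun_mul
    (differentiable_lineQ hg i x (x.1 i)).hasDerivAt).deriv
  simp only [lineQ_apply_self] at h
  rw [partialQ_eq_deriv_lineQ, partialQ_eq_deriv_lineQ, partialQ_eq_deriv_lineQ, ← h]
  rfl

/-- `∂_{p_i}` and `∂_{q_i}` are linear (subtraction) on differentiable functions. [folklore] -/
theorem partialP_sub {f g : PhaseSpace L → ℝ} (hf : Differentiable ℝ f) (hg : Differentiable ℝ g)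
    (i : Fin L) (x : PhaseSpace L) :
    partialP i (fun y => f y - g y) x = partialP i f x - partialP i g x := by
  have h := ((differentiable_lineP hf i x (x.2 i)).hasDerivAt.fun_sub
    (differentiable_lineP hg i x (x.2 i)).hasDerivAt).deriv
  rw [partialP_eq_deriv_lineP, partialP_eq_deriv_lineP, partialP_eq_deriv_lineP, ← h]
  rfl

/-- `∂_{q_i}` is linear (subtraction) on differentiable functions. [folklore] -/
theorem partialQ_sub {f g : PhaseSpace L → ℝ} (hf : Differentiable ℝ f) (hg : Differentiable ℝ g)
    (i : Fin L) (x : PhaseSpace L) :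
    partialQ i (fun y => f y - g y) x = partialQ i f x - partialQ i g x := by
  have h := ((differentiable_lineQ hf i x (x.1 i)).hasDerivAt.fun_sub
    (differentiable_lineQ hg i x (x.1 i)).hasDerivAt).deriv
  rw [partialQ_eq_deriv_lineQ, partialQ_eq_deriv_lineQ, partialQ_eq_deriv_lineQ, ← h]
  rfl

/-- `∂_{p_i}` of a constant vanishes. [folklore] -/
@[simp] theorem partialP_const (i : Fin L) (c : ℝ) (x : PhaseSpace L) :
    partialP i (fun _ => c) x = 0 := by
  simp [partialP]

/-- `∂_{q_i}` of a constant vanishes. [folklore] -/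
@[simp] theorem partialQ_const (i : Fin L) (c : ℝ) (x : PhaseSpace L) :
    partialQ i (fun _ => c) x = 0 := by
  simp [partialQ]

/-- `∂_{p_i} f ∈ C¹` for `f ∈ C²` (re-export of the tree lemma at the exponent used here). [folklore] -/
theorem differentiable_partialP_of_contDiff_two {f : PhaseSpace L → ℝ} (hf : ContDiff ℝ 2 f)
    (i : Fin L) : Differentiable ℝ (partialP i f) :=
  (contDiff_partialP hf (m := 1) (by norm_num) i).differentiable one_ne_zero

/-- `∂_{q_i} f ∈ C¹` for `f ∈ C²`. [folklore] -/
theorem contDiff_partialQ {f : PhaseSpace L → ℝ} {m n : WithTop ℕ∞} (hf : ContDiff ℝ n f)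
    (hmn : m + 1 ≤ n) (i : Fin L) : ContDiff ℝ m (partialQ i f) := by
  have hn : n ≠ 0 := by
    rintro rfl
    exact absurd hmn (by simp)
  rw [partialQ_eq_fderiv (hf.differentiable hn)]
  exact (hf.fderiv_right hmn).clm_apply contDiff_const

/-- Second-order product rule along `p_i` for `η w²`:
`∂²(η w²) = ∂²η w² + 4 ∂η w ∂w + 2 η (∂w)² + 2 η w ∂²w`. [folklore] -/
theorem deriv_deriv_mul_sq {e v : ℝ → ℝ} (he : ContDiff ℝ 2 e) (hv : ContDiff ℝ 2 v) (t : ℝ) :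
    deriv (deriv (fun s => e s * v s ^ 2)) t =
      deriv (deriv e) t * v t ^ 2 + 4 * deriv e t * v t * deriv v t +
        2 * e t * deriv v t ^ 2 + 2 * e t * v t * deriv (deriv v) t := by
  obtain ⟨he1, he2⟩ := differentiable_deriv_of_contDiff_two he
  obtain ⟨hv1, hv2⟩ := differentiable_deriv_of_contDiff_two hv
  have h1 : deriv (fun s => e s * v s ^ 2) = fun s => deriv e s * v s ^ 2 +
      e s * (2 * v s * deriv v s) := by
    funext s
    have := ((he1 s).hasDerivAt.fun_mul ((hv1 s).hasDerivAt.fun_pow 2)).deriv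
    rw [this]
    simp
  rw [h1]
  have h3 : HasDerivAt (fun s => 2 * v s * deriv v s)
      (2 * deriv v t * deriv v t + 2 * v t * deriv (deriv v) t) t := by
    have := ((hv1 t).hasDerivAt.const_mul 2).fun_mul (hv2 t).hasDerivAt
    convert this using 1
  have h2 : HasDerivAt (fun s => deriv e s * v s ^ 2 + e s * (2 * v s * deriv v s))
      (deriv (deriv e) t * v t ^ 2 + deriv e t * ((2 : ℕ) * v t ^ (2 - 1) * deriv v t) +
        (deriv e t * (2 * v t * deriv v t) +
          e t * (2 * deriv v t * deriv v t + 2 * v t * deriv (deriv v) t))) t :=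
    ((he2 t).hasDerivAt.fun_mul ((hv1 t).hasDerivAt.fun_pow 2)).fun_add
      ((he1 t).hasDerivAt.fun_mul h3)
  rw [h2.deriv]
  simp
  ring

/-- First-order product rule along a line for `η w²`: `∂(η w²) = ∂η w² + 2 η w ∂w`. [folklore] -/
theorem deriv_mul_sq {e v : ℝ → ℝ} (he : Differentiable ℝ e) (hv : Differentiable ℝ v) (t : ℝ) :
    deriv (fun s => e s * v s ^ 2) t = deriv e t * v t ^ 2 + 2 * e t * v t * deriv v t := by
  have := ((he t).hasDerivAt.fun_mul ((hv t).hasDerivAt.fun_pow 2)).deriv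
  rw [this]
  simp
  ring

end LineCalculus

/-! ## The Liouville and thermostat operators; product identities -/

section Operators

variable (P : OscillatorChain) {L : ℕ}

/-- Hamiltonian (Liouville) part of the generator: `X_H f = Σ_i (p_i ∂_{q_i} f − ∂_{q_i}H ∂_{p_i} f)`. [folklore] -/
def liouvilleOp (L : ℕ) (f : PhaseSpace L → ℝ) (x : PhaseSpace L) : ℝ :=
  ∑ i, (x.2 i * partialQ i f x - partialQ i (P.hamiltonian L) x * partialP i f x)

/-- Unit-strength Ornstein–Uhlenbeck thermostats at temperature `T` on the momenta with site
weights `B`: `Σ_i B_i (T ∂²_{p_i} f − p_i ∂_{p_i} f)`. [folklore] -/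
def bathOp (L : ℕ) (B : Fin L → ℝ) (T : ℝ) (f : PhaseSpace L → ℝ) (x : PhaseSpace L) : ℝ :=
  ∑ i, B i * (T * partialP i (partialP i f) x - x.2 i * partialP i f x)

/-- The energy cutoff `x ↦ φ(H(x)/r)`. [folklore] -/
def cutoff (φ : ℝ → ℝ) (L : ℕ) (r : ℝ) (x : PhaseSpace L) : ℝ :=
  φ (P.hamiltonian L x / r)

variable {P}

/-- `∂_{p_i}(w²) = 2 w ∂_{p_i} w`. [folklore] -/
theorem partialP_sq {w : PhaseSpace L → ℝ} (hw : Differentiable ℝ w) (i : Fin L) (x : PhaseSpace L) :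
    partialP i (fun y => w y ^ 2) x = 2 * w x * partialP i w x := by
  have : (fun y => w y ^ 2) = fun y => w y * w y := funext fun y => sq (w y)
  rw [this, partialP_mul hw hw]
  ring

/-- `∂_{q_i}(w²) = 2 w ∂_{q_i} w`. [folklore] -/
theorem partialQ_sq {w : PhaseSpace L → ℝ} (hw : Differentiable ℝ w) (i : Fin L) (x : PhaseSpace L) :
    partialQ i (fun y => w y ^ 2) x = 2 * w x * partialQ i w x := by
  have : (fun y => w y ^ 2) = fun y => w y * w y := funext fun y => sq (w y)
  rw [this, partialQ_mul hw hw]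
  ring

/-- `X_H` is a derivation: `X_H(η w²) = w² X_H η + 2 η w X_H w`. [folklore] -/
theorem liouvilleOp_mul_sq {η w : PhaseSpace L → ℝ} (hη : Differentiable ℝ η)
    (hw : Differentiable ℝ w) (x : PhaseSpace L) :
    liouvilleOp P L (fun y => η y * w y ^ 2) x =
      w x ^ 2 * liouvilleOp P L η x + 2 * η x * w x * liouvilleOp P L w x := by
  have hw2 : Differentiable ℝ (fun y => w y ^ 2) := hw.pow 2
  unfold liouvilleOp
  rw [Finset.mul_sum, Finset.mul_sum, ← Finset.sum_add_distrib]
  refine Finset.sum_congr rfl fun i _ => ?_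
  rw [partialQ_mul hη hw2, partialP_mul hη hw2, partialP_sq hw, partialQ_sq hw]
  ring

/-- Second-order Leibniz rule for the thermostats:
`S(η w²) = w² Sη + 2ηw Sw + Σ_i B_i (2Tη (∂_{p_i}w)² + 4T ∂_{p_i}η w ∂_{p_i}w)`. [folklore] -/
theorem bathOp_mul_sq {η w : PhaseSpace L → ℝ} (hη : ContDiff ℝ 2 η) (hw : ContDiff ℝ 2 w)
    (B : Fin L → ℝ) (T : ℝ) (x : PhaseSpace L) :
    bathOp L B T (fun y => η y * w y ^ 2) x =
      w x ^ 2 * bathOp L B T η x + 2 * η x * w x * bathOp L B T w x +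
        ∑ i, B i * (2 * T * η x * partialP i w x ^ 2 +
          4 * T * partialP i η x * w x * partialP i w x) := by
  have hηd : Differentiable ℝ η := hη.differentiable two_ne_zero
  have hwd : Differentiable ℝ w := hw.differentiable two_ne_zero
  unfold bathOp
  rw [Finset.mul_sum, Finset.mul_sum, ← Finset.sum_add_distrib, ← Finset.sum_add_distrib]
  refine Finset.sum_congr rfl fun i _ => ?_
  have h2 : partialP i (partialP i (fun y => η y * w y ^ 2)) x =
      partialP i (partialP i η) x * w x ^ 2 + 4 * partialP i η x * w x * partialP i w x +
        2 * η x * partialP i w x ^ 2 + 2 * η x * w x * partialP i (partialP i w) x := by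
    rw [partialP_partialP_eq, partialP_partialP_eq, partialP_partialP_eq,
      partialP_eq_deriv_lineP i η, partialP_eq_deriv_lineP i w]
    have := deriv_deriv_mul_sq (contDiff_lineP hη i x) (contDiff_lineP hw i x) (x.2 i)
    simp only [lineP_apply_self] at this
    rw [← this]
    rfl
  have h1 : partialP i (fun y => η y * w y ^ 2) x =
      partialP i η x * w x ^ 2 + 2 * η x * w x * partialP i w x := by
    rw [partialP_eq_deriv_lineP, partialP_eq_deriv_lineP i η, partialP_eq_deriv_lineP i w]
    have := deriv_mul_sq (differentiable_lineP hηd i x) (differentiable_lineP hwd i x) (x.2 i)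
    simp only [lineP_apply_self] at this
    rw [← this]
    rfl
  rw [h1, h2]
  ring

/-- `deriv` of the `p_i`-line restriction of `H` is the identity (`∂_{p_i}H = p_i` on the line). [folklore] -/
theorem deriv_lineP_hamiltonian (i : Fin L) (x : PhaseSpace L) :
    deriv (lineP i (P.hamiltonian L) x) = fun t => t := by
  rw [← lineP_partialP]
  funext t
  simp [lineP, OscillatorChain.partialP_hamiltonian]

/-- Along the `p_i`-line, `H` has derivative `t` at parameter `t`. [folklore] -/
theorem hasDerivAt_lineP_hamiltonian (hH : Differentiable ℝ (P.hamiltonian L)) (i : Fin L)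
    (x : PhaseSpace L) (t : ℝ) : HasDerivAt (lineP i (P.hamiltonian L) x) t t := by
  have h := (differentiable_lineP hH i x t).hasDerivAt
  have h2 : deriv (lineP i (P.hamiltonian L) x) t = t := by rw [deriv_lineP_hamiltonian]
  rwa [h2] at h

/-! ### The cutoff family `φ(H/r)` -/

/-- The cutoff `φ(H/r)` is smooth. [folklore] -/
theorem contDiff_cutoff {φ : ℝ → ℝ} (hφ : ContDiff ℝ ∞ φ) (hH : ContDiff ℝ ∞ (P.hamiltonian L))
    (r : ℝ) : ContDiff ℝ ∞ (cutoff P φ L r) :=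
  hφ.comp (hH.div_const r)

/-- First derivative of the line restriction of the cutoff, as a function. [folklore] -/
theorem deriv_lineP_cutoff {φ : ℝ → ℝ} (hφ : Differentiable ℝ φ)
    (hH : Differentiable ℝ (P.hamiltonian L)) (r : ℝ) (i : Fin L) (x : PhaseSpace L) :
    deriv (lineP i (cutoff P φ L r) x) =
      fun t => deriv φ (lineP i (P.hamiltonian L) x t / r) * (t / r) := by
  funext t
  exact (((hφ _).hasDerivAt).comp t ((hasDerivAt_lineP_hamiltonian hH i x t).div_const r)).deriv

/-- `∂_{p_i} φ(H/r) = φ'(H/r) p_i / r`. [folklore] -/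
theorem partialP_cutoff {φ : ℝ → ℝ} (hφ : Differentiable ℝ φ)
    (hH : Differentiable ℝ (P.hamiltonian L)) (r : ℝ) (i : Fin L) (x : PhaseSpace L) :
    partialP i (cutoff P φ L r) x = deriv φ (P.hamiltonian L x / r) * (x.2 i / r) := by
  rw [partialP_eq_deriv_lineP, deriv_lineP_cutoff hφ hH r i x]
  simp

/-- `∂²_{p_i} φ(H/r) = φ''(H/r) (p_i/r)² + φ'(H/r)/r`. [folklore] -/
theorem partialP_partialP_cutoff {φ : ℝ → ℝ} (hφ : ContDiff ℝ 2 φ)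
    (hH : Differentiable ℝ (P.hamiltonian L)) (r : ℝ) (i : Fin L) (x : PhaseSpace L) :
    partialP i (partialP i (cutoff P φ L r)) x =
      deriv (deriv φ) (P.hamiltonian L x / r) * (x.2 i / r) ^ 2 +
        deriv φ (P.hamiltonian L x / r) / r := by
  obtain ⟨hφ1, hφ2⟩ := differentiable_deriv_of_contDiff_two hφ
  rw [partialP_partialP_eq, deriv_lineP_cutoff hφ1 hH r i x]
  have hg := (hasDerivAt_lineP_hamiltonian hH i x (x.2 i)).div_const r
  have h : HasDerivAt (fun t => deriv φ (lineP i (P.hamiltonian L) x t / r) * (t / r))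
      (deriv (deriv φ) (lineP i (P.hamiltonian L) x (x.2 i) / r) * (x.2 i / r) * (x.2 i / r) +
        deriv φ (lineP i (P.hamiltonian L) x (x.2 i) / r) * (1 / r)) (x.2 i) :=
    (((hφ2 _).hasDerivAt).comp (x.2 i) hg).fun_mul ((hasDerivAt_id (x.2 i)).div_const r)
  rw [h.deriv]
  simp
  ring

/-- `∂_{q_i} φ(H/r) = φ'(H/r) ∂_{q_i}H / r`. [folklore] -/
theorem partialQ_cutoff {φ : ℝ → ℝ} (hφ : Differentiable ℝ φ)
    (hH : Differentiable ℝ (P.hamiltonian L)) (r : ℝ) (i : Fin L) (x : PhaseSpace L) :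
    partialQ i (cutoff P φ L r) x =
      deriv φ (P.hamiltonian L x / r) * (partialQ i (P.hamiltonian L) x / r) := by
  rw [partialQ_eq_deriv_lineQ, partialQ_eq_deriv_lineQ]
  have hg := ((differentiable_lineQ hH i x (x.1 i)).hasDerivAt).div_const r
  have h : HasDerivAt (lineQ i (cutoff P φ L r) x)
      (deriv φ (lineQ i (P.hamiltonian L) x (x.1 i) / r) *
        (deriv (lineQ i (P.hamiltonian L) x) (x.1 i) / r)) (x.1 i) :=
    ((hφ _).hasDerivAt).comp (x.1 i) hg
  rw [h.deriv]
  simp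

/-- The cutoff is a function of `H`, hence a first integral of `X_H`: `X_H φ(H/r) = 0`. [folklore] -/
theorem liouvilleOp_cutoff {φ : ℝ → ℝ} (hφ : Differentiable ℝ φ)
    (hH : Differentiable ℝ (P.hamiltonian L)) (r : ℝ) (x : PhaseSpace L) :
    liouvilleOp P L (cutoff P φ L r) x = 0 := by
  unfold liouvilleOp
  refine Finset.sum_eq_zero fun i _ => ?_
  rw [partialQ_cutoff hφ hH, partialP_cutoff hφ hH]
  ring

/-- Closed form of the thermostats applied to the cutoff. [folklore] -/
theorem bathOp_cutoff {φ : ℝ → ℝ} (hφ : ContDiff ℝ 2 φ) (hH : Differentiable ℝ (P.hamiltonian L))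
    (B : Fin L → ℝ) (T r : ℝ) (x : PhaseSpace L) :
    bathOp L B T (cutoff P φ L r) x =
      ∑ i, B i * (T * (deriv (deriv φ) (P.hamiltonian L x / r) * (x.2 i / r) ^ 2 +
        deriv φ (P.hamiltonian L x / r) / r) -
          x.2 i * (deriv φ (P.hamiltonian L x / r) * (x.2 i / r))) := by
  unfold bathOp
  refine Finset.sum_congr rfl fun i _ => ?_
  rw [partialP_partialP_cutoff hφ hH, partialP_cutoff (hφ.differentiable two_ne_zero) hH]

end Operators

/-- Registered helper sub-goal `helper_deviceLineCalculus` (= `bathOp_mul_sq` in stub form): the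
second-order Leibniz rule for the thermostats on `η w²`. [folklore] -/
theorem helper_deviceLineCalculus : ∀ {L : ℕ} {η w : PhaseSpace L → ℝ}, ContDiff ℝ 2 η → ContDiff ℝ 2 w → ∀ (B : Fin L → ℝ) (T : ℝ) (x : PhaseSpace L), bathOp L B T (fun y => η y * w y ^ 2) x = w x ^ 2 * bathOp L B T η x + 2 * η x * w x * bathOp L B T w x + ∑ i, B i * (2 * T * η x * partialP i w x ^ 2 + 4 * T * partialP i η x * w x * partialP i w x) :=
  fun hη hw B T x => bathOp_mul_sq hη hw B T x

end Summit.AtomisticToContinuum.FouriersLaw.Theorems.SuperadditiveResistance.DeviceLiouville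

end
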